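import Summits.HodgeConjecture.CorCM.Census.CentralSquaresPartners
import Summits.HodgeConjecture.CorCM.Prior.AllgGroup2

/-!
# The square-central class, LX: INDIRECT partners — residual closure through a path of dihedral pairs

COR-CM (cell `pub-hodgecm2`), count-neutral kernel combinatorics by the binder seat b09 (gen 50; lane SQUARE-CENTRAL CLASS, part LX), on part XLIX
(`smul_defect_mem_of_partner`, `residual_closure_partners_pow`ʼs assembly), part XXIV (`residual_closure_four_pow`), part II (`two_pow_smul_mem_of_defects`), gen 32ʼs
`thetaG_typeSum_single` and the Prior induction `single_sub_thetaG_mem`, BY NAME.  Theorems only: no definition, no `decide`, no certificate, no named fact, no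
`sorry`.  HONEST FRAMING: `HC_CM` is NOT proved, here or anywhere in the tree; nothing here is a period or a headline.

WHY.  Part XLIXʼs multi-partner closure asks for the four relation families of EVERY partner of `T₀` in the frame of `T₀`; parts LI–LIX supply them at the
partners of DIHEDRAL type.  In the rank-two affine block of Pauli `× E` one partner (`T₂ = x₃`) is quaternionic from `T₀` but dihedral from `T₁` (the D-capability
graph is the 4-cycle `T₀–T₁–T₂–T₃`); numerically (`lean-g50/py/eight.py`, `m = 4`) its families hold anyway.  This file makes the closure run THROUGH A PATH:
the star defects toward `T₀` of the types around an INDIRECT partner `T₂` are controlled by the `(T₁, T₂)` families in the frame of a direct partner `T₁` together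
with the `(T₀, T₁)` closure, at the price of doubling the exponent.

* §1 `support_thetaG_typeSum_single`: the star form `θ_T(typeSum [X])` is supported on `T` and its single flips; `single_sub_thetaG_mem_hodgeSpan`.
* §2 **CHANGE OF BASE FOR DEFECTS** (`smul_defect_base_change`): `ρ_{T₀}(X) = ρ_{T₁}(X) + (θ_{T₁} − θ_{T₀})(typeSum [X])` and the bracket is a Hodge vector on the
  four-type class of `(T₀, T₁)`; so `N·ρ_{T₁}(X) ∈ L` and `M·`(every Hodge vector on that class) `∈ L` give `(M·N)·ρ_{T₀}(X) ∈ L`.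
* §3 **INDIRECT PARTNERS** (`smul_defect_mem_of_indirect_partner`): the four families of `(T₀, T₁)` and the four families of `(T₁, T₂)` IN THE FRAME OF `T₁`
  (multiplier `2ᵏ`) put `2^{2k}·ρ_{T₀}(X)` in `L` for every `X` of the four-type class of `(T₁, T₂)` — in particular for `T₂`, `T̄₂` and their flips.
* §4 **MULTI-PARTNER RESIDUAL CLOSURE WITH INDIRECT PARTNERS** (`residual_closure_partners_indirect_pow`, socket `…_bpot`): direct partners `𝒯` with their families
  toward `T₀`, indirect partners `𝒯'` each reached from some `T₁ ∈ 𝒯` with the `(T₁, T₂)` families ⟹ every residual Hodge vector of the block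
  `{T₀, T̄₀} ∪ 𝒯 ∪ 𝒯' ∪` complements lies in `L` up to `2^{2k}`.

## References
* [Pohlmann1968] H. Pohlmann, Algebraic cycles on abelian varieties of complex multiplication type, Ann. of Math. 88 (1968), Thm 1.
-/

namespace Summit.HodgeConjecture.CorCM.Census.CentralSquares

open Finset
open scoped symmDiff
open Summit.HodgeConjecture.CorCM.Prior.AllgGroup.RfwfAllgGroup
open Summit.HodgeConjecture.CorCM.Census.BlockParity
open Summit.HodgeConjecture.CorCM.Census.Coinvariant
open Summit.HodgeConjecture.CorCM.Census.TwistGeneration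
open Summit.HodgeConjecture.CorCM.Census.BaseBlock
open Summit.HodgeConjecture.CorCM.Census.CoverClosure

noncomputable section

variable {G : Type*} [Group G] [Fintype G] [DecidableEq G] (c : G)

/-! ## §1 Support and Hodge membership of star forms -/

/-- The star form `θ_T(typeSum [X])` is supported on `T` and the single flips of `T`. [folklore] -/
theorem support_thetaG_typeSum_single (hc2 : c * c = 1) (T X : CMF G c) :
    ∀ Ψ ∈ (thetaG c hc2 T (typeSum G c (Finsupp.single X 1))).support, Ψ = T ∨ ∃ s : G, Ψ = oflipCM c hc2 s T := by
  classical
  intro Ψ hΨ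
  rw [thetaG_typeSum_single c T hc2 X] at hΨ
  rcases mem_union.mp (Finsupp.support_add hΨ) with h | h
  · obtain ⟨t, -, ht⟩ := mem_biUnion.mp (Finsupp.support_finsetSum h)
    rw [sub_eq_add_neg] at ht
    rcases mem_union.mp (Finsupp.support_add ht) with h1 | h1
    · exact Or.inr ⟨t, mem_singleton.mp (Finsupp.support_single_subset h1)⟩
    · rw [Finsupp.support_neg] at h1
      exact Or.inl (mem_singleton.mp (Finsupp.support_single_subset h1))
  · exact Or.inl (mem_singleton.mp (Finsupp.support_single_subset h))

/-- `[X] − θ_T(typeSum [X])` lies in the Hodge span (the Prior induction: it lies in the span of the faces). [folklore] -/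
theorem single_sub_thetaG_mem_hodgeSpan (hc2 : c * c = 1) (T X : CMF G c) :
    Finsupp.single X 1 - thetaG c hc2 T (typeSum G c (Finsupp.single X 1)) ∈ hodgeSpan c hc2 :=
  Submodule.mem_sup_left (single_sub_thetaG_mem c hc2 T _ X rfl)

/-! ## §2 Change of base for defects -/

/-- **CHANGE OF BASE FOR DEFECTS.**  If `N·ρ_{T₁}(X) ∈ L` and every Hodge vector supported on the four-type class of `(T₀, T₁)` lies in `L` up to `M`, then
`(M·N)·ρ_{T₀}(X) ∈ L` — since `ρ_{T₀}(X) − ρ_{T₁}(X) = θ_{T₁}(typeSum [X]) − θ_{T₀}(typeSum [X])` is such a Hodge vector. [folklore] -/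
theorem smul_defect_base_change (hc2 : c * c = 1) (T₀ T₁ X : CMF G c) (L : Submodule ℤ (CMF G c →₀ ℤ)) (M N : ℤ)
    (h01 : ∀ y ∈ hodgeSpan c hc2, (∀ Ψ ∈ y.support, Ψ = T₀ ∨ Ψ = T₁ ∨ Ψ = rt c c T₀ ∨ Ψ = rt c c T₁ ∨
      ∃ s : G, Ψ = oflipCM c hc2 s T₀ ∨ Ψ = oflipCM c hc2 s T₁ ∨ Ψ = oflipCM c hc2 s (rt c c T₀) ∨ Ψ = oflipCM c hc2 s (rt c c T₁)) → M • y ∈ L)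
    (h1 : N • (Finsupp.single X 1 - thetaG c hc2 T₁ (typeSum G c (Finsupp.single X 1))) ∈ L) :
    (M * N) • (Finsupp.single X 1 - thetaG c hc2 T₀ (typeSum G c (Finsupp.single X 1))) ∈ L := by
  set d : CMF G c →₀ ℤ := thetaG c hc2 T₁ (typeSum G c (Finsupp.single X 1)) - thetaG c hc2 T₀ (typeSum G c (Finsupp.single X 1)) with hd
  have hdH : d ∈ hodgeSpan c hc2 := by
    have e : d = (Finsupp.single X 1 - thetaG c hc2 T₀ (typeSum G c (Finsupp.single X 1))) -
        (Finsupp.single X 1 - thetaG c hc2 T₁ (typeSum G c (Finsupp.single X 1))) := by rw [hd]; abel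
    rw [e]
    exact Submodule.sub_mem _ (single_sub_thetaG_mem_hodgeSpan c hc2 T₀ X) (single_sub_thetaG_mem_hodgeSpan c hc2 T₁ X)
  have hdS : ∀ Ψ ∈ d.support, Ψ = T₀ ∨ Ψ = T₁ ∨ Ψ = rt c c T₀ ∨ Ψ = rt c c T₁ ∨
      ∃ s : G, Ψ = oflipCM c hc2 s T₀ ∨ Ψ = oflipCM c hc2 s T₁ ∨ Ψ = oflipCM c hc2 s (rt c c T₀) ∨ Ψ = oflipCM c hc2 s (rt c c T₁) := by
    intro Ψ hΨ
    rw [hd, sub_eq_add_neg] at hΨ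
    rcases mem_union.mp (Finsupp.support_add hΨ) with h | h
    · rcases support_thetaG_typeSum_single c hc2 T₁ X Ψ h with h' | ⟨s, h'⟩
      · exact Or.inr (Or.inl h')
      · exact Or.inr (Or.inr (Or.inr (Or.inr ⟨s, Or.inr (Or.inl h')⟩)))
    · rw [Finsupp.support_neg] at h
      rcases support_thetaG_typeSum_single c hc2 T₀ X Ψ h with h' | ⟨s, h'⟩
      · exact Or.inl h'
      · exact Or.inr (Or.inr (Or.inr (Or.inr ⟨s, Or.inl h'⟩)))
  have hMd : M • d ∈ L := h01 d hdH hdS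
  have e : (M * N) • (Finsupp.single X 1 - thetaG c hc2 T₀ (typeSum G c (Finsupp.single X 1))) =
      M • (N • (Finsupp.single X 1 - thetaG c hc2 T₁ (typeSum G c (Finsupp.single X 1)))) + N • (M • d) := by
    rw [hd, smul_smul, smul_smul, mul_comm N M, ← smul_add]
    congr 1
    abel
  rw [e]
  exact Submodule.add_mem _ (Submodule.smul_mem _ _ h1) (Submodule.smul_mem _ _ hMd)

/-! ## §3 Indirect partners -/

/-- **DEFECTS AROUND AN INDIRECT PARTNER.**  `T₁` a partner of `T₀` with its four families (multiplier `2ᵏ`), `T₂` a partner of `T₁` with the four families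
of `(T₁, T₂)` IN THE FRAME OF `T₁` (multiplier `2ᵏ`): then `2^{k+k}·ρ_{T₀}(X) ∈ L` for every `X` of the four-type class of `(T₁, T₂)`. [folklore] -/
theorem smul_defect_mem_of_indirect_partner (hc2 : c * c = 1) (hc1 : c ≠ 1) (hcen : ∀ x : G, x * c = c * x) (T₀ T₁ T₂ : CMF G c)
    (L : Submodule ℤ (CMF G c →₀ ℤ)) (hP : ∀ Ψ : CMF G c, pair c Ψ ∈ L) (k m : ℕ)
    -- the `(T₀, T₁)` families
    (hH : (T₀.1 \ T₁.1).card = 2 * m) (hHc : (T₀.1 ∩ T₁.1).card = 2 * m)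
    (hY : ∀ s ∈ T₀.1 \ T₁.1, ((2 : ℤ) ^ k) • ((Finsupp.single (oflipCM c hc2 s T₀) (1 : ℤ) - Finsupp.single T₀ 1) +
      (Finsupp.single (oflipCM c hc2 s T₁) (1 : ℤ) - Finsupp.single T₁ 1)) ∈ L)
    (hY' : ∀ s ∈ T₀.1 ∩ T₁.1, ((2 : ℤ) ^ k) • ((Finsupp.single (oflipCM c hc2 s T₀) (1 : ℤ) - Finsupp.single T₀ 1) -
      (Finsupp.single (oflipCM c hc2 s T₁) (1 : ℤ) - Finsupp.single T₁ 1)) ∈ L)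
    (hR : ∃ T : Finset G, T ⊆ T₀.1 \ T₁.1 ∧ T.card = m ∧
      ∑ s ∈ T, Finsupp.single (oflipCM c hc2 s T₀) (1 : ℤ) - ∑ u ∈ (T₀.1 \ T₁.1) \ T, Finsupp.single (oflipCM c hc2 u T₁) (1 : ℤ) -
        ((m : ℤ) - 1) • (Finsupp.single T₀ (1 : ℤ) - Finsupp.single T₁ 1) ∈ L)
    (hRc : ∃ T' : Finset G, T' ⊆ T₀.1 ∩ T₁.1 ∧ T'.card = m ∧
      ∑ s ∈ T', Finsupp.single (oflipCM c hc2 s T₀) (1 : ℤ) + ∑ u ∈ (T₀.1 ∩ T₁.1) \ T', Finsupp.single (oflipCM c hc2 u T₁) (1 : ℤ) -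
        ((m : ℤ) - 1) • (Finsupp.single T₀ (1 : ℤ) + Finsupp.single T₁ 1) ∈ L)
    -- the `(T₁, T₂)` families in the frame of `T₁`
    (hH₂ : (T₁.1 \ T₂.1).card = 2 * m) (hHc₂ : (T₁.1 ∩ T₂.1).card = 2 * m)
    (hY₂ : ∀ s ∈ T₁.1 \ T₂.1, ((2 : ℤ) ^ k) • ((Finsupp.single (oflipCM c hc2 s T₁) (1 : ℤ) - Finsupp.single T₁ 1) +
      (Finsupp.single (oflipCM c hc2 s T₂) (1 : ℤ) - Finsupp.single T₂ 1)) ∈ L)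
    (hY'₂ : ∀ s ∈ T₁.1 ∩ T₂.1, ((2 : ℤ) ^ k) • ((Finsupp.single (oflipCM c hc2 s T₁) (1 : ℤ) - Finsupp.single T₁ 1) -
      (Finsupp.single (oflipCM c hc2 s T₂) (1 : ℤ) - Finsupp.single T₂ 1)) ∈ L)
    (hR₂ : ∃ T : Finset G, T ⊆ T₁.1 \ T₂.1 ∧ T.card = m ∧
      ∑ s ∈ T, Finsupp.single (oflipCM c hc2 s T₁) (1 : ℤ) - ∑ u ∈ (T₁.1 \ T₂.1) \ T, Finsupp.single (oflipCM c hc2 u T₂) (1 : ℤ) -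
        ((m : ℤ) - 1) • (Finsupp.single T₁ (1 : ℤ) - Finsupp.single T₂ 1) ∈ L)
    (hRc₂ : ∃ T' : Finset G, T' ⊆ T₁.1 ∩ T₂.1 ∧ T'.card = m ∧
      ∑ s ∈ T', Finsupp.single (oflipCM c hc2 s T₁) (1 : ℤ) + ∑ u ∈ (T₁.1 ∩ T₂.1) \ T', Finsupp.single (oflipCM c hc2 u T₂) (1 : ℤ) -
        ((m : ℤ) - 1) • (Finsupp.single T₁ (1 : ℤ) + Finsupp.single T₂ 1) ∈ L) :
    ∀ X : CMF G c, (X = T₁ ∨ X = T₂ ∨ X = rt c c T₁ ∨ X = rt c c T₂ ∨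
      ∃ s : G, X = oflipCM c hc2 s T₁ ∨ X = oflipCM c hc2 s T₂ ∨ X = oflipCM c hc2 s (rt c c T₁) ∨ X = oflipCM c hc2 s (rt c c T₂)) →
      ((2 : ℤ) ^ (k + k)) • (Finsupp.single X 1 - thetaG c hc2 T₀ (typeSum G c (Finsupp.single X 1))) ∈ L := by
  intro X hX
  have h1 := smul_defect_mem_of_partner c hc2 hcen T₁ T₂ L hP ((2 : ℤ) ^ k) m hH₂ hHc₂ hY₂ hY'₂ hR₂ hRc₂ X hX
  have h01 := residual_closure_four_pow c hc2 hc1 hcen T₀ T₁ L hP k m hH hHc hY hY' hR hRc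
  rw [pow_add]
  exact smul_defect_base_change c hc2 T₀ T₁ X L ((2 : ℤ) ^ k) ((2 : ℤ) ^ k) h01 h1

/-! ## §4 Multi-partner residual closure with indirect partners -/

/-- **MULTI-PARTNER RESIDUAL CLOSURE WITH INDIRECT PARTNERS.**  `T₀` a base type; DIRECT partners `𝒯 ≠ ∅` with their four families toward `T₀` (multiplier
`2ᵏ`, `|T₀ ∖ T₁| = |T₀ ∩ T₁| = 2m`); INDIRECT partners `𝒯'`, each `T₂ ∈ 𝒯'` reached from some direct `T₁ ∈ 𝒯` (`|T₁ ∖ T₂| = |T₁ ∩ T₂| = 2m`) with the four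
families of `(T₁, T₂)` in the frame of `T₁`.  Then every Hodge vector supported on `T₀`, `T̄₀`, all partners, their complements and all their single flips
lies in `L` up to `2^{2k}`. [folklore] -/
theorem residual_closure_partners_indirect_pow (hc2 : c * c = 1) (hc1 : c ≠ 1) (hcen : ∀ x : G, x * c = c * x) (T₀ : CMF G c)
    (𝒯 𝒯' : Finset (CMF G c)) (h𝒯 : 𝒯.Nonempty)
    (L : Submodule ℤ (CMF G c →₀ ℤ)) (hP : ∀ Ψ : CMF G c, pair c Ψ ∈ L) (k m : ℕ)
    (hH : ∀ T₁ ∈ 𝒯, (T₀.1 \ T₁.1).card = 2 * m) (hHc : ∀ T₁ ∈ 𝒯, (T₀.1 ∩ T₁.1).card = 2 * m)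
    (hY : ∀ T₁ ∈ 𝒯, ∀ s ∈ T₀.1 \ T₁.1, ((2 : ℤ) ^ k) • ((Finsupp.single (oflipCM c hc2 s T₀) (1 : ℤ) - Finsupp.single T₀ 1) +
      (Finsupp.single (oflipCM c hc2 s T₁) (1 : ℤ) - Finsupp.single T₁ 1)) ∈ L)
    (hY' : ∀ T₁ ∈ 𝒯, ∀ s ∈ T₀.1 ∩ T₁.1, ((2 : ℤ) ^ k) • ((Finsupp.single (oflipCM c hc2 s T₀) (1 : ℤ) - Finsupp.single T₀ 1) -
      (Finsupp.single (oflipCM c hc2 s T₁) (1 : ℤ) - Finsupp.single T₁ 1)) ∈ L)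
    (hR : ∀ T₁ ∈ 𝒯, ∃ T : Finset G, T ⊆ T₀.1 \ T₁.1 ∧ T.card = m ∧
      ∑ s ∈ T, Finsupp.single (oflipCM c hc2 s T₀) (1 : ℤ) - ∑ u ∈ (T₀.1 \ T₁.1) \ T, Finsupp.single (oflipCM c hc2 u T₁) (1 : ℤ) -
        ((m : ℤ) - 1) • (Finsupp.single T₀ (1 : ℤ) - Finsupp.single T₁ 1) ∈ L)
    (hRc : ∀ T₁ ∈ 𝒯, ∃ T' : Finset G, T' ⊆ T₀.1 ∩ T₁.1 ∧ T'.card = m ∧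
      ∑ s ∈ T', Finsupp.single (oflipCM c hc2 s T₀) (1 : ℤ) + ∑ u ∈ (T₀.1 ∩ T₁.1) \ T', Finsupp.single (oflipCM c hc2 u T₁) (1 : ℤ) -
        ((m : ℤ) - 1) • (Finsupp.single T₀ (1 : ℤ) + Finsupp.single T₁ 1) ∈ L)
    (hvia : ∀ T₂ ∈ 𝒯', ∃ T₁ ∈ 𝒯, (T₁.1 \ T₂.1).card = 2 * m ∧ (T₁.1 ∩ T₂.1).card = 2 * m ∧
      (∀ s ∈ T₁.1 \ T₂.1, ((2 : ℤ) ^ k) • ((Finsupp.single (oflipCM c hc2 s T₁) (1 : ℤ) - Finsupp.single T₁ 1) +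
        (Finsupp.single (oflipCM c hc2 s T₂) (1 : ℤ) - Finsupp.single T₂ 1)) ∈ L) ∧
      (∀ s ∈ T₁.1 ∩ T₂.1, ((2 : ℤ) ^ k) • ((Finsupp.single (oflipCM c hc2 s T₁) (1 : ℤ) - Finsupp.single T₁ 1) -
        (Finsupp.single (oflipCM c hc2 s T₂) (1 : ℤ) - Finsupp.single T₂ 1)) ∈ L) ∧
      (∃ T : Finset G, T ⊆ T₁.1 \ T₂.1 ∧ T.card = m ∧
        ∑ s ∈ T, Finsupp.single (oflipCM c hc2 s T₁) (1 : ℤ) - ∑ u ∈ (T₁.1 \ T₂.1) \ T, Finsupp.single (oflipCM c hc2 u T₂) (1 : ℤ) -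
          ((m : ℤ) - 1) • (Finsupp.single T₁ (1 : ℤ) - Finsupp.single T₂ 1) ∈ L) ∧
      (∃ T' : Finset G, T' ⊆ T₁.1 ∩ T₂.1 ∧ T'.card = m ∧
        ∑ s ∈ T', Finsupp.single (oflipCM c hc2 s T₁) (1 : ℤ) + ∑ u ∈ (T₁.1 ∩ T₂.1) \ T', Finsupp.single (oflipCM c hc2 u T₂) (1 : ℤ) -
          ((m : ℤ) - 1) • (Finsupp.single T₁ (1 : ℤ) + Finsupp.single T₂ 1) ∈ L)) :
    ∀ y ∈ hodgeSpan c hc2, (∀ Ψ ∈ y.support, Ψ = T₀ ∨ Ψ = rt c c T₀ ∨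
      (∃ s : G, Ψ = oflipCM c hc2 s T₀ ∨ Ψ = oflipCM c hc2 s (rt c c T₀)) ∨
      ∃ T₁ ∈ 𝒯 ∪ 𝒯', Ψ = T₁ ∨ Ψ = rt c c T₁ ∨ ∃ s : G, Ψ = oflipCM c hc2 s T₁ ∨ Ψ = oflipCM c hc2 s (rt c c T₁)) →
      ((2 : ℤ) ^ (k + k)) • y ∈ L := by
  classical
  -- direct partners: `2^k`, hence `2^(k+k)`
  have hup : ∀ z : CMF G c →₀ ℤ, ((2 : ℤ) ^ k) • z ∈ L → ((2 : ℤ) ^ (k + k)) • z ∈ L := by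
    intro z hz; rw [pow_add, ← smul_smul]; exact Submodule.smul_mem _ _ hz
  have hpart : ∀ T₁ ∈ 𝒯, ∀ X : CMF G c, (X = T₀ ∨ X = T₁ ∨ X = rt c c T₀ ∨ X = rt c c T₁ ∨
      ∃ s : G, X = oflipCM c hc2 s T₀ ∨ X = oflipCM c hc2 s T₁ ∨ X = oflipCM c hc2 s (rt c c T₀) ∨ X = oflipCM c hc2 s (rt c c T₁)) →
      ((2 : ℤ) ^ (k + k)) • (Finsupp.single X 1 - thetaG c hc2 T₀ (typeSum G c (Finsupp.single X 1))) ∈ L :=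
    fun T₁ hT₁ X hX => hup _ (smul_defect_mem_of_partner c hc2 hcen T₀ T₁ L hP ((2 : ℤ) ^ k) m (hH T₁ hT₁) (hHc T₁ hT₁) (hY T₁ hT₁)
      (hY' T₁ hT₁) (hR T₁ hT₁) (hRc T₁ hT₁) X hX)
  have hind : ∀ T₂ ∈ 𝒯', ∀ X : CMF G c, (X = T₂ ∨ X = rt c c T₂ ∨ ∃ s : G, X = oflipCM c hc2 s T₂ ∨ X = oflipCM c hc2 s (rt c c T₂)) →
      ((2 : ℤ) ^ (k + k)) • (Finsupp.single X 1 - thetaG c hc2 T₀ (typeSum G c (Finsupp.single X 1))) ∈ L := by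
    intro T₂ hT₂ X hX
    obtain ⟨T₁, hT₁, hH₂, hHc₂, hY₂, hY'₂, hR₂, hRc₂⟩ := hvia T₂ hT₂
    refine smul_defect_mem_of_indirect_partner c hc2 hc1 hcen T₀ T₁ T₂ L hP k m (hH T₁ hT₁) (hHc T₁ hT₁) (hY T₁ hT₁) (hY' T₁ hT₁) (hR T₁ hT₁)
      (hRc T₁ hT₁) hH₂ hHc₂ hY₂ hY'₂ hR₂ hRc₂ X ?_
    rcases hX with h | h | ⟨s, h | h⟩
    · exact Or.inr (Or.inl h)
    · exact Or.inr (Or.inr (Or.inr (Or.inl h)))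
    · exact Or.inr (Or.inr (Or.inr (Or.inr ⟨s, Or.inr (Or.inl h)⟩)))
    · exact Or.inr (Or.inr (Or.inr (Or.inr ⟨s, Or.inr (Or.inr (Or.inr h))⟩)))
  obtain ⟨T₁, hT₁⟩ := h𝒯
  refine two_pow_smul_mem_of_defects c hc2 hc1 hcen T₀ L hP
    (fun Ψ => Ψ = T₀ ∨ Ψ = rt c c T₀ ∨ (∃ s : G, Ψ = oflipCM c hc2 s T₀ ∨ Ψ = oflipCM c hc2 s (rt c c T₀)) ∨
      ∃ T₁ ∈ 𝒯 ∪ 𝒯', Ψ = T₁ ∨ Ψ = rt c c T₁ ∨ ∃ s : G, Ψ = oflipCM c hc2 s T₁ ∨ Ψ = oflipCM c hc2 s (rt c c T₁))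
    (Or.inl rfl) (Or.inr (Or.inl rfl)) (k + k) fun X hX => ?_
  rcases hX with h | h | ⟨s, h | h⟩ | ⟨T₂, hT₂, hX⟩
  · exact hpart T₁ hT₁ X (Or.inl h)
  · exact hpart T₁ hT₁ X (Or.inr (Or.inr (Or.inl h)))
  · exact hpart T₁ hT₁ X (Or.inr (Or.inr (Or.inr (Or.inr ⟨s, Or.inl h⟩))))
  · exact hpart T₁ hT₁ X (Or.inr (Or.inr (Or.inr (Or.inr ⟨s, Or.inr (Or.inr (Or.inl h))⟩))))
  · rcases mem_union.mp hT₂ with hd | hi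
    · rcases hX with h | h | ⟨s, h | h⟩
      · exact hpart T₂ hd X (Or.inr (Or.inl h))
      · exact hpart T₂ hd X (Or.inr (Or.inr (Or.inr (Or.inl h))))
      · exact hpart T₂ hd X (Or.inr (Or.inr (Or.inr (Or.inr ⟨s, Or.inr (Or.inl h)⟩))))
      · exact hpart T₂ hd X (Or.inr (Or.inr (Or.inr (Or.inr ⟨s, Or.inr (Or.inr (Or.inr h))⟩))))
    · exact hind T₂ hi X hX

/-- **THE SOCKET with indirect partners**: if the base changes of `T₀` are `T₀`, `T̄₀`, the types of `𝒯 ∪ 𝒯'` and their complements, the closure above is the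
residual-closure hypothesis of the cover-closure law (`bpot T₀ Ψ ≤ 1`) with exponent `2k`. [folklore] -/
theorem residual_closure_partners_indirect_bpot (hc2 : c * c = 1) (hc1 : c ≠ 1) (hcen : ∀ x : G, x * c = c * x) (T₀ : CMF G c)
    (𝒯 𝒯' : Finset (CMF G c)) (h𝒯 : 𝒯.Nonempty)
    (hbase : ∀ Q : G, rt c Q T₀ = T₀ ∨ rt c Q T₀ = rt c c T₀ ∨ ∃ T₁ ∈ 𝒯 ∪ 𝒯', rt c Q T₀ = T₁ ∨ rt c Q T₀ = rt c c T₁)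
    (L : Submodule ℤ (CMF G c →₀ ℤ)) (hP : ∀ Ψ : CMF G c, pair c Ψ ∈ L) (k m : ℕ)
    (hH : ∀ T₁ ∈ 𝒯, (T₀.1 \ T₁.1).card = 2 * m) (hHc : ∀ T₁ ∈ 𝒯, (T₀.1 ∩ T₁.1).card = 2 * m)
    (hY : ∀ T₁ ∈ 𝒯, ∀ s ∈ T₀.1 \ T₁.1, ((2 : ℤ) ^ k) • ((Finsupp.single (oflipCM c hc2 s T₀) (1 : ℤ) - Finsupp.single T₀ 1) +
      (Finsupp.single (oflipCM c hc2 s T₁) (1 : ℤ) - Finsupp.single T₁ 1)) ∈ L)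
    (hY' : ∀ T₁ ∈ 𝒯, ∀ s ∈ T₀.1 ∩ T₁.1, ((2 : ℤ) ^ k) • ((Finsupp.single (oflipCM c hc2 s T₀) (1 : ℤ) - Finsupp.single T₀ 1) -
      (Finsupp.single (oflipCM c hc2 s T₁) (1 : ℤ) - Finsupp.single T₁ 1)) ∈ L)
    (hR : ∀ T₁ ∈ 𝒯, ∃ T : Finset G, T ⊆ T₀.1 \ T₁.1 ∧ T.card = m ∧
      ∑ s ∈ T, Finsupp.single (oflipCM c hc2 s T₀) (1 : ℤ) - ∑ u ∈ (T₀.1 \ T₁.1) \ T, Finsupp.single (oflipCM c hc2 u T₁) (1 : ℤ) -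
        ((m : ℤ) - 1) • (Finsupp.single T₀ (1 : ℤ) - Finsupp.single T₁ 1) ∈ L)
    (hRc : ∀ T₁ ∈ 𝒯, ∃ T' : Finset G, T' ⊆ T₀.1 ∩ T₁.1 ∧ T'.card = m ∧
      ∑ s ∈ T', Finsupp.single (oflipCM c hc2 s T₀) (1 : ℤ) + ∑ u ∈ (T₀.1 ∩ T₁.1) \ T', Finsupp.single (oflipCM c hc2 u T₁) (1 : ℤ) -
        ((m : ℤ) - 1) • (Finsupp.single T₀ (1 : ℤ) + Finsupp.single T₁ 1) ∈ L)
    (hvia : ∀ T₂ ∈ 𝒯', ∃ T₁ ∈ 𝒯, (T₁.1 \ T₂.1).card = 2 * m ∧ (T₁.1 ∩ T₂.1).card = 2 * m ∧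
      (∀ s ∈ T₁.1 \ T₂.1, ((2 : ℤ) ^ k) • ((Finsupp.single (oflipCM c hc2 s T₁) (1 : ℤ) - Finsupp.single T₁ 1) +
        (Finsupp.single (oflipCM c hc2 s T₂) (1 : ℤ) - Finsupp.single T₂ 1)) ∈ L) ∧
      (∀ s ∈ T₁.1 ∩ T₂.1, ((2 : ℤ) ^ k) • ((Finsupp.single (oflipCM c hc2 s T₁) (1 : ℤ) - Finsupp.single T₁ 1) -
        (Finsupp.single (oflipCM c hc2 s T₂) (1 : ℤ) - Finsupp.single T₂ 1)) ∈ L) ∧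
      (∃ T : Finset G, T ⊆ T₁.1 \ T₂.1 ∧ T.card = m ∧
        ∑ s ∈ T, Finsupp.single (oflipCM c hc2 s T₁) (1 : ℤ) - ∑ u ∈ (T₁.1 \ T₂.1) \ T, Finsupp.single (oflipCM c hc2 u T₂) (1 : ℤ) -
          ((m : ℤ) - 1) • (Finsupp.single T₁ (1 : ℤ) - Finsupp.single T₂ 1) ∈ L) ∧
      (∃ T' : Finset G, T' ⊆ T₁.1 ∩ T₂.1 ∧ T'.card = m ∧
        ∑ s ∈ T', Finsupp.single (oflipCM c hc2 s T₁) (1 : ℤ) + ∑ u ∈ (T₁.1 ∩ T₂.1) \ T', Finsupp.single (oflipCM c hc2 u T₂) (1 : ℤ) -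
          ((m : ℤ) - 1) • (Finsupp.single T₁ (1 : ℤ) + Finsupp.single T₂ 1) ∈ L)) :
    ∀ y ∈ hodgeSpan c hc2, (∀ Ψ ∈ y.support, bpot c T₀ Ψ ≤ 1) → ((2 : ℤ) ^ (k + k)) • y ∈ L := by
  intro y hy hyR
  refine residual_closure_partners_indirect_pow c hc2 hc1 hcen T₀ 𝒯 𝒯' h𝒯 L hP k m hH hHc hY hY' hR hRc hvia y hy fun Ψ hΨ => ?_
  rcases residual_cases c T₀ hc2 (hyR Ψ hΨ) with ⟨Q', rfl⟩ | ⟨Q', s, -, rfl⟩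
  · rcases hbase Q' with h | h | ⟨T₁, hT₁, h | h⟩
    · exact Or.inl h
    · exact Or.inr (Or.inl h)
    · exact Or.inr (Or.inr (Or.inr ⟨T₁, hT₁, Or.inl h⟩))
    · exact Or.inr (Or.inr (Or.inr ⟨T₁, hT₁, Or.inr (Or.inl h)⟩))
  · rw [rt_oflipCM]
    rcases hbase Q' with h | h | ⟨T₁, hT₁, h | h⟩
    · exact Or.inr (Or.inr (Or.inl ⟨s * Q'⁻¹, Or.inl (by rw [h])⟩))
    · exact Or.inr (Or.inr (Or.inl ⟨s * Q'⁻¹, Or.inr (by rw [h])⟩))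
    · exact Or.inr (Or.inr (Or.inr ⟨T₁, hT₁, Or.inr (Or.inr ⟨s * Q'⁻¹, Or.inl (by rw [h])⟩)⟩))
    · exact Or.inr (Or.inr (Or.inr ⟨T₁, hT₁, Or.inr (Or.inr ⟨s * Q'⁻¹, Or.inr (by rw [h])⟩)⟩))

end

end Summit.HodgeConjecture.CorCM.Census.CentralSquares
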